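import Literature.AlgebraicGeometry.Resolution.RamificationInAmbientField
import Literature.AlgebraicGeometry.Resolution.DefectAmbient
import HarnessLib

/-!
# Constant extensions of an Abhyankar valued function field: the residue degree stabilizes
# (Temkin 2013, Thm. 5.5.3, from the generalized stability theorem)

Topic: `Literature/AlgebraicGeometry/Resolution` (valued function fields). The counting half of a
PROVED reduction of Temkin 2013, Thm. 5.5.3 (`Temkin2013_Thm553`, `AbhyankarToroidalCharts.lean`;
M. Temkin, *Inseparable local uniformization*, J. Algebra 373 (2013) 65–119 = arXiv:0804.1554v3,
p. 61) to the generalized stability theorem (`Kuhlmann2010Stability`, `ValuationDefect.lean`),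
the "difficult result" its printed proof invokes (Remark 2.1.3: "if `k` is stable then `l` is
stable … [Kuh]"; proof of Thm. 5.5.3: "Since `L̄` is an Abhyankar field over `k̄`, it is stable and
the stability allows us to control the extension `K̄/L̄` in terms of the valuation groups and the
residue fields").

## Setting (ambient rendering)

Everything happens inside ONE valued field `(Ω, V)` containing the trivially valued ground field
`k ⊆ V` (in the application: an algebraic closure of the function field `K` with an extension `V`
of `K°`). Fixed data: an Abhyankar system `B = y ⊔ x` (`y : Fin F → V` with residues algebraically
independent over `k`, `x : Fin E → Ω^×` with `ℤ`-independent values; `IsAmbientAbhyankarSystem`)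
and a finite set `T ⊆ Ω` of elements integral over `k(B)` (generators of `K` over `k(B)`). For a
set of "constants" `S ⊆ P := perfectClosure k Ω` the **level `S`** consists of the fields
`L_S := k(S, B)` (`levL`) and `M_S := L_S(T) = K(S)` (`levM`), valued by `V`; `S = ∅` is the
function field `K/k(B)` itself, `S = P` is Temkin's `K̄ = k̄K` over `L̄ = k̄(B)`, and the finite
`S ⊆ P` are the constant extensions `lK/l(B)`, `l = k(S)`.

## Content (all PROVED, `Kuhlmann2010Stability` entering as an explicit hypothesis)

* `transcendenceDefect_eq_zero_of_isAlgebraic` — a valued field generated up to an algebraic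
  extension by an Abhyankar system has transcendence defect `0` (so `Kuhlmann2010Stability`
  applies to every level `L_S / k(S)`: `isDefectlessIn_level`).
* Level bookkeeping: `Lk`, `Mk` (the intermediate fields `k(S, B) ≤ k(S, B, T)` of `Ω/k`),
  `levL`, `levM` (the same fields as types, `L_S` an extension of `l_S = k(S)` and `M_S` of `L_S`,
  sealed after their basic API), carriers, monotonicity, inclusions `inclL`, `inclM`, `k(S) ⊆ V`,
  generation and finiteness (`fg_top_levL`, `finiteDimensional_levM`), the Abhyankar hypotheses
  at every level and for every valuation ring `V'` of `Ω` with `V' ∩ k(B) = V ∩ k(B)`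
  (`IsAmbientAbhyankarSystem.of_forall_mem_iff`, `.algebraicIndependent_lS`), `|L_S^×| = Λ_B`
  (`valGroup_Lk_eq_closure`), `(L_S)~ = l̃_S(ȳ)` (`resField_Lk_eq`); `e` and `f` of a level read
  off in the ambient value group / residue field (`ramificationIndex_level_eq_relIndex`,
  `inertiaDegree_level_eq_relfinrank`); agreement of valuation rings on `k(S₀, B)` propagates to
  all levels `S ⊆ P` (`forall_mem_Lk_iff_of_forall_mem_Lk_iff`, purely inseparable uniqueness).
* Stabilization along `S ↑ P` for such `V'`: the value group of `M_S` is eventually that of `M_P`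
  (`exists_valGroup_Mk_eq`, so the ramification indices agree,
  `ramificationIndex_level_eq_of_valGroup_eq`), the inertia degree is eventually AT LEAST that at
  level `P` (`exists_inertiaDegree_level_ge`), the degree `[M_S : L_S]` is eventually `[M_P : L_P]`
  (`exists_finrank_level_eq`), and restriction of valuation rings from `M_P` to `M_S` is
  eventually injective on any finite set (`exists_injOn_comap_inclM`).
* `exists_inertiaDegree_level_eq` — **the counting theorem**: if `Kuhlmann2010Stability` holds, then
  for all sufficiently large `S ⊆ P` the inertia degree of `V ∩ M_S` over `L_S` EQUALS that of
  `V ∩ M_P` over `L_P` (defectlessness `∑ e f = n` at the levels `S` and `P`, the extensions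
  corresponding under restriction, compared term by term).

The separability consequences (the residue field of `M_S` is separably generated over that of
`k(S)`) and the assembly of `Temkin2013_Thm553` are in `AbhyankarResidueSeparability.lean`.

## Source and deviation

M. Temkin, arXiv:0804.1554v3, Thm. 5.5.3 and its proof (p. 61). The printed proof runs a tower of
degree-`p` steps (after a Sylow reduction) and finds, by stability of `L̄`, an element of `K̄` with
a new value or a new residue; the present argument applies the same stability theorem to the
whole finite extension `K̄/k̄(B)` and to its finite-level forms `lK/l(B)` at once and compares the
defect formulas, which avoids the Galois-theoretic reductions.
[cite: Temkin2013, Thm. 5.5.3 (p. 61 of arXiv:0804.1554v3)]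
-/

noncomputable section

namespace Literature.AlgebraicGeometry.Resolution

open IsLocalRing ValuationSubring IntermediateField

universe u

/-! ### Transcendence defect of a field generated by an Abhyankar system -/

/-- **A valued field algebraic over the field generated by an Abhyankar system has transcendence
defect `0`.** If `k₁ ⊆ K₁°` is trivially valued, `x : Fin E → K₁^×` has `ℤ`-independent values,
`y : Fin F → K₁°` has residues algebraically independent over `k₁`, and `K₁` is algebraic over
`k₁(x, y)`, then `D_{K₁/k₁} = 0` (indeed `(x, y)` is a transcendence basis, `tr.deg = E + F`,
while `E ≤ rat.rk` and `F ≤ tr.deg K̃₁`, and Abhyankar's inequality). [folklore] -/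
theorem transcendenceDefect_eq_zero_of_isAlgebraic {k₁ K₁ : Type u} [Field k₁] [Field K₁]
    [Algebra k₁ K₁] (O₁ : ValuationSubring K₁) (hk₁ : ∀ c : k₁, algebraMap k₁ K₁ c ∈ O₁)
    {E F : ℕ} (x₁ : Fin E → K₁) (y₁ : Fin F → O₁) (hx0 : ∀ j, x₁ j ≠ 0)
    (hx : LinearIndependent ℤ fun j =>
      Additive.ofMul (Units.mk0 (O₁.valuation (x₁ j)) (valuation_ne_zero_of_ne_zero O₁ (hx0 j))))
    (hy : letI := algebraOfMem k₁ O₁ hk₁; AlgebraicIndependent k₁ fun i => residue O₁ (y₁ i))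
    (hgen : Algebra.IsAlgebraic
      (IntermediateField.adjoin k₁ (Set.range (Sum.elim x₁ fun i => (y₁ i : K₁)))) K₁) :
    transcendenceDefect k₁ O₁ hk₁ = 0 := by
  letI := algebraOfMem k₁ O₁ hk₁
  haveI := isScalarTower_algebraOfMem k₁ O₁ hk₁
  have hBind : AlgebraicIndependent k₁ (Sum.elim x₁ fun i => (y₁ i : K₁)) :=
    algebraicIndependent_sumElim_of_valuation O₁ y₁ hy x₁ (injective_valuation_prod_pow O₁ x₁ hx0 hx)
  have hB : IsTranscendenceBasis k₁ (Sum.elim x₁ fun i => (y₁ i : K₁)) :=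
    isTranscendenceBasis_iff_algebraicIndependent_isAlgebraic.mpr
      ⟨hBind, IntermediateField.isAlgebraic_adjoin_iff_top.mp hgen⟩
  -- `tr.deg = E + F`
  have htr : Algebra.trdeg k₁ K₁ = ((E + F : ℕ) : Cardinal) := by
    have h := hB.lift_cardinalMk_eq_trdeg
    simp only [Cardinal.mk_sum, Cardinal.mk_fin, Cardinal.lift_natCast, Cardinal.lift_add] at h
    have h' : Cardinal.lift.{0, u} (Algebra.trdeg k₁ K₁) = ((E + F : ℕ) : Cardinal) := by
      rw [← h]; push_cast; rfl
    exact Cardinal.lift_injective (by rw [h', Cardinal.lift_natCast])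
  have hN : Algebra.trdeg k₁ K₁ < Cardinal.aleph0 := by
    rw [htr]; exact Cardinal.natCast_lt_aleph0
  -- `E ≤ rat.rk`, `F ≤ tr.deg K̃₁`
  have hE : (E : Cardinal) ≤ ratRank O₁ := by
    have h := hx.cardinal_lift_le_rank
    rw [Cardinal.mk_fin, Cardinal.lift_natCast] at h
    unfold ratRank
    have h2 : Cardinal.lift.{0, u} (Module.rank ℤ (Additive (ValueGroup O₁)ˣ)) =
        Module.rank ℤ (Additive (ValueGroup O₁)ˣ) := Cardinal.lift_uzero _
    rwa [h2] at h
  have hF : (F : Cardinal) ≤ residueTrdeg k₁ O₁ hk₁ := by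
    have h := hy.lift_cardinalMk_le_trdeg
    rw [Cardinal.mk_fin, Cardinal.lift_natCast] at h
    rw [residueTrdeg_eq O₁ hk₁]
    have h2 : Cardinal.lift.{0, u} (Algebra.trdeg k₁ (ResidueField O₁)) =
        Algebra.trdeg k₁ (ResidueField O₁) := Cardinal.lift_uzero _
    rwa [h2] at h
  refine (transcendenceDefect_eq_zero_iff O₁ hk₁ hN).mpr (le_antisymm
    (ratRank_add_residueTrdeg_le_trdeg O₁ hk₁) ?_)
  rw [htr, Nat.cast_add]
  exact add_le_add hE hF

variable {k Ω : Type u} [Field k] [Field Ω] [Algebra k Ω]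

/-! ### Abhyankar systems of an ambient valued field -/

/-- **An Abhyankar system of the ambient valued field `(Ω, V)` over the trivially valued
`k ⊆ V`** (Temkin 2013, §2.1, condition (*), pp. 9–10): `x : Fin E → Ω^×` with values
`ℤ`-linearly independent in the value group of `V`, and `y : Fin F → V` with residues
algebraically independent over `k`. [cite: Temkin2013, Section 2.1 (pp. 9–10 of arXiv:0804.1554v3)] -/
structure IsAmbientAbhyankarSystem (V : ValuationSubring Ω) (hk : ∀ c : k, algebraMap k Ω c ∈ V)
    {E F : ℕ} (x : Fin E → Ω) (y : Fin F → Ω) : Prop where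
  ne_zero : ∀ j, x j ≠ 0
  mem : ∀ i, y i ∈ V
  linearIndependent : LinearIndependent ℤ fun j =>
    Additive.ofMul (Units.mk0 (V.valuation (x j)) (valuation_ne_zero_of_ne_zero V (ne_zero j)))
  algebraicIndependent :
    letI := algebraOfMem k V hk
    AlgebraicIndependent k fun i => residue V ⟨y i, mem i⟩

/-! ### The levels `l_S = k(S)`, `L_S = k(S, B)` and `M_S = k(S, B, T)` -/

section Levels

variable (k) {E F : ℕ} (x : Fin E → Ω) (y : Fin F → Ω) (T : Finset Ω)

/-- The set `B = B_F ⊔ B_E` underlying the Abhyankar system (in the order `range y ∪ range x` of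
`AbhyankarInvariants.lean`). [folklore] -/
def abhSet : Set Ω := (Set.range y) ∪ Set.range x

/-- **Level `S`, constants**: the field `l_S = k(S)` (for `S ⊆ k^{1/p^∞}` a set of constants;
Temkin 2013, proof of Thm. 5.5.3: "a `k`-finite subfield `l ⊂ k̄`", `k̄ = k^{1/p^∞}`).
[cite: Temkin2013, proof of Thm. 5.5.3 (p. 61 of arXiv:0804.1554v3)] -/
abbrev lS (S : Set Ω) : IntermediateField k Ω := adjoin k S

/-- **Level `S`, base, over `k`**: the field `L_S = k(S, B)` (Temkin 2013, proof of Thm. 5.5.3: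
`lL`, `L̄ = k̄L` with `L = k(B)`). [cite: Temkin2013, proof of Thm. 5.5.3 (p. 61 of arXiv:0804.1554v3)] -/
def Lk (S : Set Ω) : IntermediateField k Ω := adjoin k (S ∪ abhSet x y)

/-- **Level `S`, top, over `k`**: the field `M_S = k(S, B, T) = L_S(T)` (Temkin 2013, proof of
Thm. 5.5.3: `lK`, `K̄ = k̄K`, when `T` generates `K` over `k(B)`).
[cite: Temkin2013, proof of Thm. 5.5.3 (p. 61 of arXiv:0804.1554v3)] -/
def Mk (S : Set Ω) : IntermediateField k Ω := adjoin k (S ∪ abhSet x y ∪ ↑T)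

variable {k x y T}

/-- `l_S ≤ L_S`. [folklore] -/
theorem lS_le_Lk (S : Set Ω) : lS k S ≤ Lk k x y S := adjoin.mono k _ _ Set.subset_union_left

/-- `l_S ≤ M_S`. [folklore] -/
theorem lS_le_Mk (S : Set Ω) : lS k S ≤ Mk k x y T S :=
  adjoin.mono k _ _ (Set.subset_union_left.trans Set.subset_union_left)

/-- `L_S ≤ M_S`. [folklore] -/
theorem Lk_le_Mk (S : Set Ω) : Lk k x y S ≤ Mk k x y T S := adjoin.mono k _ _ Set.subset_union_left

/-- `L_S` is monotone in `S`. [folklore] -/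
theorem Lk_mono {S S' : Set Ω} (h : S ⊆ S') : Lk k x y S ≤ Lk k x y S' :=
  adjoin.mono k _ _ (Set.union_subset_union_left _ h)

/-- `M_S` is monotone in `S`. [folklore] -/
theorem Mk_mono {S S' : Set Ω} (h : S ⊆ S') : Mk k x y T S ≤ Mk k x y T S' :=
  adjoin.mono k _ _ (Set.union_subset_union_left _ (Set.union_subset_union_left _ h))

/-- `B ⊆ L_S`. [folklore] -/
theorem abhSet_subset_Lk (S : Set Ω) : abhSet x y ⊆ (Lk k x y S : Set Ω) := fun _ ha =>
  subset_adjoin k _ (Or.inr ha)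

/-- `xⱼ ∈ L_S`. [folklore] -/
theorem x_mem_Lk (S : Set Ω) (j : Fin E) : x j ∈ Lk k x y S := abhSet_subset_Lk S (Or.inr ⟨j, rfl⟩)

/-- `yᵢ ∈ L_S`. [folklore] -/
theorem y_mem_Lk (S : Set Ω) (i : Fin F) : y i ∈ Lk k x y S := abhSet_subset_Lk S (Or.inl ⟨i, rfl⟩)

/-- `T ⊆ M_S`. [folklore] -/
theorem subset_Mk (S : Set Ω) : (T : Set Ω) ⊆ (Mk k x y T S : Set Ω) := fun _ ha =>
  subset_adjoin k _ (Or.inr ha)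

variable (k x y) in
/-- **Level `S`, base**: `L_S` as an extension of the constants `l_S` (the type on which the
valuation ring `V ∩ L_S` and the generalized stability theorem live). [folklore] -/
def levL (S : Set Ω) : IntermediateField (lS k S) Ω :=
  extendScalars (lS_le_Lk (x := x) (y := y) S)

variable (k x y T) in
/-- **Level `S`, top**: `M_S` as a (finite) extension of `L_S`. [folklore] -/
def levM (S : Set Ω) : IntermediateField (levL k x y S) Ω :=
  extendScalars (F := levL k x y S) (E := extendScalars (lS_le_Mk (x := x) (y := y) (T := T) S))
    (Lk_le_Mk (x := x) (y := y) (T := T) S)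

/-- Membership in `L_S`. [folklore] -/
theorem mem_levL_iff (S : Set Ω) (a : Ω) : a ∈ levL k x y S ↔ a ∈ Lk k x y S := Iff.rfl

/-- Membership in `M_S`. [folklore] -/
theorem mem_levM_iff (S : Set Ω) (a : Ω) : a ∈ levM k x y T S ↔ a ∈ Mk k x y T S := Iff.rfl

/-- The carrier of `L_S`. [folklore] -/
theorem coe_levL (S : Set Ω) : (levL k x y S : Set Ω) = Lk k x y S := rfl

/-- The carrier of `M_S`. [folklore] -/
theorem coe_levM (S : Set Ω) : (levM k x y T S : Set Ω) = Mk k x y T S := rfl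

/-- The image of `L_S → Ω` is `L_S`. [folklore] -/
theorem fieldRange_levL (S : Set Ω) :
    (algebraMap (levL k x y S) Ω).fieldRange = (Lk k x y S).toSubfield := by
  ext a
  constructor
  · rintro ⟨b, rfl⟩; exact b.2
  · intro ha; exact ⟨⟨a, ha⟩, rfl⟩

/-- The image of `M_S → Ω` is `M_S`. [folklore] -/
theorem fieldRange_levM (S : Set Ω) :
    (algebraMap (levM k x y T S) Ω).fieldRange = (Mk k x y T S).toSubfield := by
  ext a
  constructor
  · rintro ⟨b, rfl⟩; exact b.2
  · intro ha; exact ⟨⟨a, ha⟩, rfl⟩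

/-- The image of `l_S → Ω` is `l_S`. [folklore] -/
theorem fieldRange_lS (S : Set Ω) : (algebraMap (lS k S) Ω).fieldRange = (lS k S).toSubfield := by
  ext a
  constructor
  · rintro ⟨b, rfl⟩; exact b.2
  · intro ha; exact ⟨⟨a, ha⟩, rfl⟩

variable (k x y) in
/-- The inclusion `L_S → L_{S'}` for `S ⊆ S'`. [folklore] -/
def inclL {S S' : Set Ω} (h : S ⊆ S') : levL k x y S →+* levL k x y S' :=
  (inclusion (Lk_mono (x := x) (y := y) h)).toRingHom

variable (k x y T) in
/-- The inclusion `M_S → M_{S'}` for `S ⊆ S'`. [folklore] -/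
def inclM {S S' : Set Ω} (h : S ⊆ S') : levM k x y T S →+* levM k x y T S' :=
  (inclusion (Mk_mono (x := x) (y := y) (T := T) h)).toRingHom

/-- The inclusion `M_S → M_{S'}` on elements. [folklore] -/
theorem coe_inclM {S S' : Set Ω} (h : S ⊆ S') (a : levM k x y T S) :
    ((inclM k x y T h a : levM k x y T S') : Ω) = a :=
  coe_inclusion (Mk_mono (x := x) (y := y) (T := T) h) a

/-- The inclusion `L_S → L_{S'}` on elements. [folklore] -/
theorem coe_inclL {S S' : Set Ω} (h : S ⊆ S') (a : levL k x y S) :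
    ((inclL k x y h a : levL k x y S') : Ω) = a :=
  coe_inclusion (Lk_mono (x := x) (y := y) h) a

/-- Integrality over the type `L_S` is integrality over the intermediate field `k(S, B)`.
[folklore] -/
theorem isIntegral_levL_iff (S : Set Ω) (t : Ω) :
    IsIntegral (levL k x y S) t ↔ IsIntegral (Lk k x y S) t := Iff.rfl

/-- Integrality over the type `M_S` is integrality over the intermediate field `k(S, B, T)`.
[folklore] -/
theorem isIntegral_levM_iff (S : Set Ω) (t : Ω) :
    IsIntegral (levM k x y T S) t ↔ IsIntegral (Mk k x y T S) t := Iff.rfl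

/-! The level fields are used as TYPES from now on; their definitional unfolding (two nested
`extendScalars` over `adjoin`) is expensive for the unifier, so it is sealed: use `mem_levL_iff`,
`mem_levM_iff`, `coe_levL`, `coe_levM`, `isIntegral_levL_iff`. -/
attribute [irreducible] levL levM

/-- Restricting a valuation ring of `Ω` to `M_{S'}` and then to `M_S` is restricting it to `M_S`.
[folklore] -/
theorem comap_inclM_comap {S S' : Set Ω} (h : S ⊆ S') (V' : ValuationSubring Ω) :
    (V'.comap (algebraMap (levM k x y T S') Ω)).comap (inclM k x y T h) =
      V'.comap (algebraMap (levM k x y T S) Ω) := by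
  ext a
  simp only [ValuationSubring.mem_comap]
  rw [show algebraMap (levM k x y T S') Ω (inclM k x y T h a) =
    ((inclM k x y T h a : levM k x y T S') : Ω) from rfl, coe_inclM]
  rfl

/-- Restricting to `M_S` and then to `L_S` is restricting to `L_S`. [folklore] -/
theorem comap_levM_comap_levL (S : Set Ω) (V' : ValuationSubring Ω) :
    (V'.comap (algebraMap (levM k x y T S) Ω)).comap (algebraMap (levL k x y S) (levM k x y T S)) =
      V'.comap (algebraMap (levL k x y S) Ω) := by
  rw [ValuationSubring.comap_comap, ← IsScalarTower.algebraMap_eq]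

/-- Two valuation rings of `Ω` have the same restriction to `L_S` iff they have the same trace on
`L_S`. [folklore] -/
theorem comap_levL_eq_iff (S : Set Ω) (V' V'' : ValuationSubring Ω) :
    V'.comap (algebraMap (levL k x y S) Ω) = V''.comap (algebraMap (levL k x y S) Ω) ↔
      ∀ a ∈ Lk k x y S, a ∈ V' ↔ a ∈ V'' := by
  constructor
  · intro h a ha
    have := congrArg (fun O : ValuationSubring (levL k x y S) =>
      (⟨a, (mem_levL_iff S a).mpr ha⟩ : levL k x y S) ∈ O) h
    simpa [ValuationSubring.mem_comap] using this
  · intro h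
    ext a
    simpa [ValuationSubring.mem_comap] using h a ((mem_levL_iff S a).mp a.2)

/-- The same for `M_S`. [folklore] -/
theorem comap_levM_eq_iff (S : Set Ω) (V' V'' : ValuationSubring Ω) :
    V'.comap (algebraMap (levM k x y T S) Ω) = V''.comap (algebraMap (levM k x y T S) Ω) ↔
      ∀ a ∈ Mk k x y T S, a ∈ V' ↔ a ∈ V'' := by
  constructor
  · intro h a ha
    have := congrArg (fun O : ValuationSubring (levM k x y T S) =>
      (⟨a, (mem_levM_iff S a).mpr ha⟩ : levM k x y T S) ∈ O) h
    simpa [ValuationSubring.mem_comap] using this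
  · intro h
    ext a
    simpa [ValuationSubring.mem_comap] using h a ((mem_levM_iff S a).mp a.2)

/-- An element of `M_S` lies in a finite sublevel: `M_S = ⋃ M_C` over finite `C ⊆ S`.
[folklore] -/
theorem exists_finset_mem_Mk {S : Set Ω} {a : Ω} (ha : a ∈ Mk k x y T S) :
    ∃ C : Finset Ω, ↑C ⊆ S ∧ a ∈ Mk k x y T (C : Set Ω) := by
  classical
  obtain ⟨C₀, hC₀, haC₀⟩ := exists_finset_of_mem_adjoin ha
  refine ⟨C₀.filter (· ∈ S), fun c hc => (Finset.mem_filter.mp hc).2, ?_⟩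
  refine adjoin.mono k _ _ ?_ haC₀
  intro c hc
  rcases hC₀ hc with (hcS | hcB) | hcT
  · exact Or.inl (Or.inl (Finset.mem_filter.mpr ⟨hc, hcS⟩))
  · exact Or.inl (Or.inr hcB)
  · exact Or.inr hcT

/-- An element of `L_S` lies in a finite sublevel. [folklore] -/
theorem exists_finset_mem_Lk {S : Set Ω} {a : Ω} (ha : a ∈ Lk k x y S) :
    ∃ C : Finset Ω, ↑C ⊆ S ∧ a ∈ Lk k x y (C : Set Ω) := by
  classical
  obtain ⟨C₀, hC₀, haC₀⟩ := exists_finset_of_mem_adjoin ha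
  refine ⟨C₀.filter (· ∈ S), fun c hc => (Finset.mem_filter.mp hc).2, ?_⟩
  refine adjoin.mono k _ _ ?_ haC₀
  intro c hc
  rcases hC₀ hc with hcS | hcB
  · exact Or.inl (Finset.mem_filter.mpr ⟨hc, hcS⟩)
  · exact Or.inr hcB

/-! ### Constants are integral: `l_S ⊆ V'` for every valuation ring `V' ⊇ k` -/

/-- A field generated over `k ⊆ V'` by algebraic elements lies in the valuation ring `V'`
(valuation rings are integrally closed). [folklore] -/
theorem adjoin_subset_valuationSubring (V' : ValuationSubring Ω) (hk : ∀ c : k, algebraMap k Ω c ∈ V')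
    {S : Set Ω} (hS : ∀ a ∈ S, IsAlgebraic k a) : (adjoin k S : Set Ω) ⊆ V' := by
  intro a ha
  letI := algebraOfMem k V' hk
  haveI := isScalarTower_algebraOfMem k V' hk
  haveI : Algebra.IsAlgebraic k (adjoin k S) := (isAlgebraic_adjoin_iff_isAlgebraic k Ω).mpr hS
  have h1 : IsAlgebraic k (⟨a, ha⟩ : adjoin k S) := Algebra.IsAlgebraic.isAlgebraic _
  have h2 : IsIntegral k a := (isAlgebraic_iff.mp h1).isIntegral
  have h3 : IsIntegral V' a := h2.tower_top
  obtain ⟨b, hb⟩ := IsIntegrallyClosed.algebraMap_eq_of_integral h3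
  rw [← hb]
  exact b.2

/-- Elements of the perfect closure `P = k^{1/p^∞} ∩ Ω` are algebraic over `k`. [folklore] -/
theorem isAlgebraic_of_mem_perfectClosure {a : Ω} (ha : a ∈ perfectClosure k Ω) : IsAlgebraic k a :=
  isAlgebraic_iff.mp (Algebra.IsAlgebraic.isAlgebraic (⟨a, ha⟩ : perfectClosure k Ω))

/-- `l_S = k(S) ⊆ V'` for `S ⊆ P` and any valuation ring `V' ⊇ k` of `Ω`: the constants are
trivially valued. [folklore] -/
theorem lS_subset_valuationSubring (V' : ValuationSubring Ω) (hk : ∀ c : k, algebraMap k Ω c ∈ V')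
    {S : Set Ω} (hS : S ⊆ (perfectClosure k Ω : Set Ω)) : (lS k S : Set Ω) ⊆ V' :=
  adjoin_subset_valuationSubring V' hk fun _ ha => isAlgebraic_of_mem_perfectClosure (hS ha)

/-- The constants `l_S` are algebraic over `k` (for `S ⊆ P`). [folklore] -/
theorem isAlgebraic_lS {S : Set Ω} (hS : S ⊆ (perfectClosure k Ω : Set Ω)) :
    Algebra.IsAlgebraic k (lS k S) :=
  (isAlgebraic_adjoin_iff_isAlgebraic k Ω).mpr fun _ ha => isAlgebraic_of_mem_perfectClosure (hS ha)

/-! ### `L_S = l_S(B)` and `M_S = L_S(T)`: generation, finiteness -/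

/-- `L_S` is generated over `l_S` by (any set of its elements mapping onto) `B`. [folklore] -/
theorem adjoin_lS_eq_top (S : Set Ω) (X : Set (levL k x y S)) (hX : Subtype.val '' X = abhSet x y) :
    adjoin (lS k S) X = ⊤ := by
  apply lift_injective (levL k x y S)
  rw [lift_adjoin, lift_top, hX]
  apply SetLike.ext'
  rw [coe_levL]
  change ((adjoin (lS k S) (abhSet x y)).restrictScalars k : Set Ω) = (Lk k x y S : Set Ω)
  rw [restrictScalars_adjoin]
  congr 1
  change adjoin k (↑(adjoin k S) ∪ abhSet x y) = Lk k x y S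
  apply le_antisymm
  · refine adjoin_le_iff.mpr ?_
    rintro a (ha | ha)
    · exact lS_le_Lk S ha
    · exact abhSet_subset_Lk S ha
  · refine adjoin.mono k _ _ ?_
    rintro a (ha | ha)
    · exact Or.inl (subset_adjoin k S ha)
    · exact Or.inr ha

/-- `B`, pulled back to `L_S`, is finite. [folklore] -/
theorem finite_preimage_abhSet (S : Set Ω) :
    (Subtype.val ⁻¹' abhSet x y : Set (levL k x y S)).Finite :=
  ((Set.finite_range y).union (Set.finite_range x)).preimage Subtype.val_injective.injOn

/-- `B`, pulled back to `L_S` and pushed to `Ω`, is `B`. [folklore] -/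
theorem image_preimage_abhSet (S : Set Ω) :
    Subtype.val '' (Subtype.val ⁻¹' abhSet x y : Set (levL k x y S)) = abhSet x y := by
  rw [Set.image_preimage_eq_of_subset]
  intro a ha
  exact ⟨⟨a, (mem_levL_iff S a).mpr (abhSet_subset_Lk S ha)⟩, rfl⟩

/-- `L_S / l_S` is finitely generated (by `B`). [folklore] -/
theorem fg_top_levL (S : Set Ω) : (⊤ : IntermediateField (lS k S) (levL k x y S)).FG := by
  classical
  refine ⟨(finite_preimage_abhSet (k := k) (x := x) (y := y) S).toFinset, ?_⟩
  rw [Set.Finite.coe_toFinset]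
  exact adjoin_lS_eq_top S _ (image_preimage_abhSet S)

/-- `M_S = L_S(T)` as intermediate fields over `L_S`. [folklore] -/
theorem adjoin_levL_eq_levM (S : Set Ω) : adjoin (levL k x y S) (T : Set Ω) = levM k x y T S := by
  apply le_antisymm
  · refine adjoin_le_iff.mpr ?_
    rw [coe_levM]
    exact subset_Mk S
  · intro a ha
    rw [mem_levM_iff] at ha
    have hle : Mk k x y T S ≤
        ((adjoin (levL k x y S) (T : Set Ω)).restrictScalars (lS k S)).restrictScalars k := by
      refine adjoin_le_iff.mpr ?_
      rintro b (hb | hb)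
      · exact (adjoin (levL k x y S) (T : Set Ω)).algebraMap_mem
          ⟨b, (mem_levL_iff S b).mpr (subset_adjoin k _ hb)⟩
      · exact (mem_restrictScalars k).mpr ((mem_restrictScalars (lS k S)).mpr
          (subset_adjoin (levL k x y S) (T : Set Ω) hb))
    exact hle ha

/-- `M_S` is finite over `L_S` when `T` consists of elements integral over `L_S`. [folklore] -/
theorem finiteDimensional_levM {S : Set Ω} (hT : ∀ t ∈ T, IsIntegral (levL k x y S) t) :
    FiniteDimensional (levL k x y S) (levM k x y T S) := by
  rw [← adjoin_levL_eq_levM]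
  exact finiteDimensional_adjoin hT

/-- Integrality over `L_S` persists over `L_{S'}`, `S ⊆ S'`. [folklore] -/
theorem isIntegral_levL_mono {S S' : Set Ω} (h : S ⊆ S') {t : Ω} (ht : IsIntegral (levL k x y S) t) :
    IsIntegral (levL k x y S') t := by
  letI : Algebra (levL k x y S) (levL k x y S') := (inclL k x y h).toAlgebra
  haveI : IsScalarTower (levL k x y S) (levL k x y S') Ω :=
    IsScalarTower.of_algebraMap_eq fun a => (coe_inclL h a).symm
  exact ht.tower_top

end Levels

/-! ### The Abhyankar hypotheses at every level and for every valuation ring agreeing on `k(B)` -/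

namespace IsAmbientAbhyankarSystem

variable {V : ValuationSubring Ω} {hk : ∀ c : k, algebraMap k Ω c ∈ V} {E F : ℕ} {x : Fin E → Ω}
  {y : Fin F → Ω}

/-- **The Abhyankar hypotheses only depend on the trace of the valuation ring on `k(B)`**: if `V'`
is another valuation ring of `Ω` containing `k` with `V' ∩ k(B) = V ∩ k(B)`, then `(x, y)` is an
Abhyankar system for `V'` as well (the values of monomials in `x` and of polynomials in `y` are
units of `V` iff of `V'`). [folklore] -/
theorem of_forall_mem_iff (hB : IsAmbientAbhyankarSystem V hk x y) {V' : ValuationSubring Ω}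
    (hk' : ∀ c : k, algebraMap k Ω c ∈ V')
    (h : ∀ a ∈ Lk k x y (∅ : Set Ω), a ∈ V ↔ a ∈ V') : IsAmbientAbhyankarSystem V' hk' x y := by
  have h' : ∀ a ∈ (Lk k x y (∅ : Set Ω)).toSubfield, a ∈ V ↔ a ∈ V' := h
  have hmem : ∀ i, y i ∈ V' := fun i => (h _ (y_mem_Lk _ i)).mp (hB.mem i)
  exact
    { ne_zero := hB.ne_zero
      mem := hmem
      linearIndependent := linearIndependent_valuation_of_forall_mem_iff h' x hB.ne_zero
        (x_mem_Lk _) hB.linearIndependent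
      algebraicIndependent := algebraicIndependent_residue_of_forall_mem_iff h' hk hk'
        (fun c => (Lk k x y ∅).algebraMap_mem c) y hB.mem hmem (y_mem_Lk _)
        hB.algebraicIndependent }

/-- The residues `ỹᵢ` stay algebraically independent over the constants `l_S = k(S)`, `S ⊆ P`
(which are algebraic over `k`). [folklore] -/
theorem algebraicIndependent_lS (hB : IsAmbientAbhyankarSystem V hk x y) {S : Set Ω}
    (hS : S ⊆ (perfectClosure k Ω : Set Ω)) :
    letI := algebraOfMem (lS k S) V (fun c => lS_subset_valuationSubring V hk hS c.2)
    AlgebraicIndependent (lS k S) fun i => residue V ⟨y i, hB.mem i⟩ := by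
  letI i1 := algebraOfMem k V hk
  letI i2 := algebraOfMem (lS k S) V (fun c => lS_subset_valuationSubring V hk hS c.2)
  haveI : IsScalarTower k (lS k S) (ResidueField V) := IsScalarTower.of_algebraMap_eq fun c => by
    change residue V (algebraMap k V c) = residue V (algebraMap (lS k S) V (algebraMap k (lS k S) c))
    congr 1
  haveI : Algebra.IsAlgebraic k (lS k S) := isAlgebraic_lS hS
  exact hB.algebraicIndependent.extendScalars (lS k S)

/-- **`|L_S^×| = Λ_B`** at every level: the values of the non-zero elements of `L_S = k(S)(B)` form
the subgroup generated by the `|xⱼ|` (Temkin 2013, §5.3, p. 55: "`Λ_B := |K_B^×|` is a sublattice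
of `Λ` generated by `|B_E|`"; `mk0_valuation_mem_closure_of_mem_adjoin` over the trivially valued
`l_S`). [cite: Temkin2013, Section 5.3 (p. 55 of arXiv:0804.1554v3)] -/
theorem valGroup_Lk_eq_closure (hB : IsAmbientAbhyankarSystem V hk x y) {S : Set Ω}
    (hS : S ⊆ (perfectClosure k Ω : Set Ω)) :
    valGroup V (Lk k x y S).toSubfield =
      Subgroup.closure (Set.range fun j =>
        Units.mk0 (V.valuation (x j)) (valuation_ne_zero_of_ne_zero V (hB.ne_zero j))) := by
  letI i2 := algebraOfMem (lS k S) V (fun c => lS_subset_valuationSubring V hk hS c.2)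
  haveI : IsScalarTower (lS k S) V Ω := isScalarTower_algebraOfMem (lS k S) V _
  have hy := hB.algebraicIndependent_lS hS
  apply le_antisymm
  · rintro γ ⟨a, ha, hγ⟩
    have ha0 : a ≠ 0 := fun h0 => by
      rw [h0, map_zero] at hγ
      exact γ.ne_zero hγ
    have ha' : a ∈ IntermediateField.adjoin (lS k S)
        ((Set.range fun i => ((⟨y i, hB.mem i⟩ : V) : Ω)) ∪ Set.range x) := by
      have h1 : a ∈ (adjoin (lS k S) (abhSet x y)).restrictScalars k := by
        rw [adjoin_adjoin_left]; exact ha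
      exact h1
    have hmem := mk0_valuation_mem_closure_of_mem_adjoin V (fun i => (⟨y i, hB.mem i⟩ : V)) x hy
      hB.ne_zero hB.linearIndependent ha' ha0
    have hγ' : γ = Units.mk0 (V.valuation a) (valuation_ne_zero_of_ne_zero V ha0) := Units.ext hγ
    rw [hγ']
    exact hmem
  · refine (Subgroup.closure_le _).mpr ?_
    rintro _ ⟨j, rfl⟩
    exact mk0_mem_valGroup V (x_mem_Lk S j) (hB.ne_zero j)

/-- The image of the constants `l_S` in the residue field: the range of `l_S → Ṽ` is the residue
field of `l_S`. [folklore] -/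
theorem range_algebraMap_lS (V : ValuationSubring Ω) (hk : ∀ c : k, algebraMap k Ω c ∈ V)
    {S : Set Ω} (hS : S ⊆ (perfectClosure k Ω : Set Ω)) :
    letI := algebraOfMem (lS k S) V (fun c => lS_subset_valuationSubring V hk hS c.2)
    Set.range (algebraMap (lS k S) (ResidueField V)) = (resField V (lS k S).toSubfield : Set _) := by
  letI i2 := algebraOfMem (lS k S) V (fun c => lS_subset_valuationSubring V hk hS c.2)
  ext r
  rw [SetLike.mem_coe, mem_resField_iff]
  constructor
  · rintro ⟨c, rfl⟩
    exact ⟨algebraMap (lS k S) V c, c.2, rfl⟩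
  · rintro ⟨a, ha, rfl⟩
    exact ⟨⟨a, ha⟩, congrArg (residue V) (Subtype.ext rfl)⟩

/-- **`(L_S)~ = l̃_S(ȳ)`** at every level: the residue field of `L_S = k(S)(B)` is generated over
that of the constants `l_S` by the residues `ỹᵢ` (`residue_mem_adjoin_of_mem_adjoin` over the
trivially valued `l_S`; Knaf–Kuhlmann 2005, Thm. 2.1: "`K(x, y)P = KP(yP)`"). [cite: KnafKuhlmann2005, Thm. 2.1] -/
theorem resField_Lk_eq (hB : IsAmbientAbhyankarSystem V hk x y) {S : Set Ω}
    (hS : S ⊆ (perfectClosure k Ω : Set Ω)) :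
    resField V (Lk k x y S).toSubfield =
      Subfield.closure ((resField V (lS k S).toSubfield : Set (ResidueField V)) ∪
        Set.range fun i => residue V ⟨y i, hB.mem i⟩) := by
  letI i2 := algebraOfMem (lS k S) V (fun c => lS_subset_valuationSubring V hk hS c.2)
  haveI : IsScalarTower (lS k S) V Ω := isScalarTower_algebraOfMem (lS k S) V _
  have hy := hB.algebraicIndependent_lS hS
  apply le_antisymm
  · intro r hr
    obtain ⟨a, ha, rfl⟩ := (mem_resField_iff V _ r).mp hr
    have ha' : (a : Ω) ∈ IntermediateField.adjoin (lS k S)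
        ((Set.range fun i => ((⟨y i, hB.mem i⟩ : V) : Ω)) ∪ Set.range x) := by
      have h1 : (a : Ω) ∈ (adjoin (lS k S) (abhSet x y)).restrictScalars k := by
        rw [adjoin_adjoin_left]; exact ha
      exact h1
    have hmem := residue_mem_adjoin_of_mem_adjoin V (fun i => (⟨y i, hB.mem i⟩ : V)) x hy
      hB.ne_zero hB.linearIndependent ha' a.2
    have hmem' : residue V a ∈ (IntermediateField.adjoin (lS k S)
        (Set.range fun i => residue V (⟨y i, hB.mem i⟩ : V))).toSubfield := hmem
    rw [adjoin_toSubfield, range_algebraMap_lS V hk hS] at hmem'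
    exact hmem'
  · refine Subfield.closure_le.mpr ?_
    rintro r (hr | ⟨i, rfl⟩)
    · exact resField_mono V (lS_le_Lk (x := x) (y := y) S) hr
    · exact residue_mem_resField V _ (y_mem_Lk S i)

end IsAmbientAbhyankarSystem

/-! ### The generalized stability theorem at a level -/

section Stability

variable {V : ValuationSubring Ω} {hk : ∀ c : k, algebraMap k Ω c ∈ V} {E F : ℕ} {x : Fin E → Ω}
  {y : Fin F → Ω} {T : Finset Ω} {S : Set Ω}

/-- The constants lie in the valuation ring of the level: `l_S ⊆ V ∩ L_S`. [folklore] -/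
theorem algebraMap_lS_mem_comap (hk : ∀ c : k, algebraMap k Ω c ∈ V)
    (hS : S ⊆ (perfectClosure k Ω : Set Ω)) (c : lS k S) :
    algebraMap (lS k S) (levL k x y S) c ∈ V.comap (algebraMap (levL k x y S) Ω) := by
  rw [ValuationSubring.mem_comap, ← IsScalarTower.algebraMap_apply]
  exact lS_subset_valuationSubring V hk hS c.2

/-- **Every level `L_S / l_S` is an Abhyankar valued function field without transcendence
defect** (`S ⊆ P`): the system `(x, y)` keeps independent values and residues for `V ∩ L_S`
over the constants `l_S`, and generates `L_S`. [folklore] -/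
theorem transcendenceDefect_levL_eq_zero (hB : IsAmbientAbhyankarSystem V hk x y)
    (hS : S ⊆ (perfectClosure k Ω : Set Ω)) :
    transcendenceDefect (lS k S) (V.comap (algebraMap (levL k x y S) Ω))
      (algebraMap_lS_mem_comap hk hS) = 0 := by
  set O₁ := V.comap (algebraMap (levL k x y S) Ω) with hO₁
  have hk₁ := algebraMap_lS_mem_comap (x := x) (y := y) hk hS
  -- the system at level `S`
  let x₁ : Fin E → levL k x y S := fun j => ⟨x j, (mem_levL_iff S _).mpr (x_mem_Lk S j)⟩
  have hx₁0 : ∀ j, x₁ j ≠ 0 := fun j h => hB.ne_zero j (congrArg Subtype.val h)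
  let y₁ : Fin F → O₁ := fun i =>
    ⟨⟨y i, (mem_levL_iff S _).mpr (y_mem_Lk S i)⟩, ValuationSubring.mem_comap.mpr (hB.mem i)⟩
  -- independence of the values
  have hx₁ : LinearIndependent ℤ fun j =>
      Additive.ofMul (Units.mk0 (O₁.valuation (x₁ j)) (valuation_ne_zero_of_ne_zero O₁ (hx₁0 j))) := by
    rw [linearIndependent_valuation_iff O₁ x₁ hx₁0]
    have hx := hB.linearIndependent
    rw [linearIndependent_valuation_iff V x hB.ne_zero] at hx
    intro s g hg
    refine hx s g ?_
    rw [valuation_comap_eq_one_iff V] at hg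
    have hcoe : algebraMap (levL k x y S) Ω (∏ j ∈ s, x₁ j ^ g j) = ∏ j ∈ s, x j ^ g j := by
      rw [map_prod]
      exact Finset.prod_congr rfl fun j _ => map_zpow₀ _ _ _
    rwa [hcoe] at hg
  -- independence of the residues
  letI := algebraOfMem (lS k S) O₁ hk₁
  letI iV := algebraOfMem (lS k S) V (fun c => lS_subset_valuationSubring V hk hS c.2)
  have hy₁ : AlgebraicIndependent (lS k S) fun i => residue O₁ (y₁ i) := by
    have hamb := hB.algebraicIndependent_lS hS
    refine AlgebraicIndependent.of_ringHom_of_comp_eq (RingHom.id (lS k S))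
      (residueFieldHom (levL k x y S) V) ?_ Function.injective_id ?_
    · convert hamb using 1
      funext i
      simp only [Function.comp_apply]
      rw [residueFieldHom_residue]
      rfl
    · ext c
      change residueFieldHom (levL k x y S) V (residue O₁ (algebraMap (lS k S) O₁ c)) =
        residue V (algebraMap (lS k S) V c)
      rw [residueFieldHom_residue]
      rfl
  -- generation
  have hgen : Algebra.IsAlgebraic (IntermediateField.adjoin (lS k S)
      (Set.range (Sum.elim x₁ fun i => (y₁ i : levL k x y S)))) (levL k x y S) := by
    have htop : IntermediateField.adjoin (lS k S)
        (Set.range (Sum.elim x₁ fun i => (y₁ i : levL k x y S))) = ⊤ := by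
      refine adjoin_lS_eq_top S _ ?_
      rw [← Set.range_comp]
      ext a
      simp only [Set.mem_range, Function.comp_apply, abhSet, Set.mem_union]
      constructor
      · rintro ⟨(j | i), rfl⟩
        · exact Or.inr ⟨j, rfl⟩
        · exact Or.inl ⟨i, rfl⟩
      · rintro (⟨i, rfl⟩ | ⟨j, rfl⟩)
        · exact ⟨Sum.inr i, rfl⟩
        · exact ⟨Sum.inl j, rfl⟩
    rw [htop]
    exact ⟨fun z => isAlgebraic_algebraMap (R := (⊤ : IntermediateField (lS k S) (levL k x y S)))
      (⟨z, IntermediateField.mem_top⟩ : (⊤ : IntermediateField (lS k S) (levL k x y S)))⟩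
  exact transcendenceDefect_eq_zero_of_isAlgebraic O₁ hk₁ x₁ y₁ hx₁0 hx₁ hy₁ hgen

/-- **The generalized stability theorem at level `S`**: if `Kuhlmann2010Stability` holds, then
`V ∩ L_S` is defectless in the finite extension `M_S = L_S(T)` — there is a finite set consisting
of all valuation rings of `M_S` over `V ∩ L_S`, and `∑ e f = [M_S : L_S]` over it (Temkin 2013,
proof of Thm. 5.5.3: "Since `L̄` is an Abhyankar field over `k̄`, it is stable"; here for every
`S ⊆ P`, the finite levels included). [cite: Temkin2013, proof of Thm. 5.5.3 (p. 61 of arXiv:0804.1554v3)] -/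
theorem isDefectlessIn_level (hKS : Kuhlmann2010Stability.{u}) (hB : IsAmbientAbhyankarSystem V hk x y)
    (hT : ∀ t ∈ T, IsIntegral (levL k x y S) t) (hS : S ⊆ (perfectClosure k Ω : Set Ω)) :
    IsDefectlessIn (levL k x y S) (V.comap (algebraMap (levL k x y S) Ω)) (levM k x y T S) :=
  hKS (lS k S) (levL k x y S) (fg_top_levL S) _ (algebraMap_lS_mem_comap hk hS)
    (transcendenceDefect_levL_eq_zero hB hS) (levM k x y T S) (finiteDimensional_levM hT)

end Stability

/-! ### `e` and `f` of a level read off in the ambient value group and residue field -/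

section Ambient

variable {E F : ℕ} {x : Fin E → Ω} {y : Fin F → Ω} {T : Finset Ω}

variable (k Ω) in
/-- The perfect closure `P = k^{1/p^∞} ∩ Ω` of `k` in `Ω`, as a set of constants (Temkin 2013,
proof of Thm. 5.5.3: `k̄ = k^{1/p^∞}`). [cite: Temkin2013, proof of Thm. 5.5.3 (p. 61 of arXiv:0804.1554v3)] -/
abbrev PSet : Set Ω := (perfectClosure k Ω : Set Ω)

/-- **`e(V' ∩ M_S / L_S) = [|M_S^×| : |L_S^×|]`** inside the value group of `V'`. [folklore] -/
theorem ramificationIndex_level_eq_relIndex (S : Set Ω) (V' : ValuationSubring Ω) :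
    ramificationIndex (levL k x y S) (V'.comap (algebraMap (levM k x y T S) Ω)) =
      (valGroup V' (Lk k x y S).toSubfield).relIndex (valGroup V' (Mk k x y T S).toSubfield) := by
  rw [ramificationIndex_comap_eq_relIndex V' (levL k x y S) (levM k x y T S), valueSubgroup_eq_valGroup,
    valueSubgroup_eq_valGroup, fieldRange_levL, fieldRange_levM]

/-- **`f(V' ∩ M_S / L_S) = [M̃_S : L̃_S]`** inside the residue field of `V'`. [folklore] -/
theorem inertiaDegree_level_eq_relfinrank (S : Set Ω) (V' : ValuationSubring Ω) :
    inertiaDegree (levL k x y S) (V'.comap (algebraMap (levM k x y T S) Ω)) =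
      (resField V' (Lk k x y S).toSubfield).relfinrank (resField V' (Mk k x y T S).toSubfield) := by
  rw [inertiaDegree_comap_eq_relfinrank V' (levL k x y S) (levM k x y T S),
    residueSubfield_eq_resField, residueSubfield_eq_resField, fieldRange_levL, fieldRange_levM]

/-- **Agreement on `k(S₀, B)` propagates to all constant levels**: two valuation rings of `Ω`
with the same trace on `L_{S₀}` have the same trace on `L_S` for every `S ⊆ P` (the elements of
`L_S` are purely inseparable over `L_{S₀} ⊇ k(B)`). [folklore] -/
theorem forall_mem_Lk_iff_of_forall_mem_Lk_iff {V' V'' : ValuationSubring Ω} {S₀ S : Set Ω}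
    (hS : S ⊆ PSet k Ω) (h : ∀ a ∈ Lk k x y S₀, a ∈ V' ↔ a ∈ V'') :
    ∀ a ∈ Lk k x y S, a ∈ V' ↔ a ∈ V'' := by
  intro a ha
  refine mem_iff_mem_of_mem_perfectClosure (F := Lk k x y S₀) ?_ ?_
  · rintro _ ⟨c, rfl⟩
    exact h _ c.2
  · have hle : Lk k x y S ≤ (perfectClosure (Lk k x y S₀) Ω).restrictScalars k := by
      refine adjoin_le_iff.mpr ?_
      rintro b (hb | hb)
      · exact mem_perfectClosure_of_mem_perfectClosure_of_tower (Lk k x y S₀) (hS hb)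
      · exact (perfectClosure (Lk k x y S₀) Ω).algebraMap_mem ⟨b, abhSet_subset_Lk S₀ hb⟩
    exact hle ha

/-- The same for the top fields: agreement on `M_{S₀}` propagates to `M_S`, `S ⊆ P`. [folklore] -/
theorem forall_mem_Mk_iff_of_forall_mem_Mk_iff {V' V'' : ValuationSubring Ω} {S₀ S : Set Ω}
    (hS : S ⊆ PSet k Ω) (h : ∀ a ∈ Mk k x y T S₀, a ∈ V' ↔ a ∈ V'') :
    ∀ a ∈ Mk k x y T S, a ∈ V' ↔ a ∈ V'' := by
  intro a ha
  refine mem_iff_mem_of_mem_perfectClosure (F := Mk k x y T S₀) ?_ ?_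
  · rintro _ ⟨c, rfl⟩
    exact h _ c.2
  · have hle : Mk k x y T S ≤ (perfectClosure (Mk k x y T S₀) Ω).restrictScalars k := by
      refine adjoin_le_iff.mpr ?_
      rintro b ((hb | hb) | hb)
      · exact mem_perfectClosure_of_mem_perfectClosure_of_tower (Mk k x y T S₀) (hS hb)
      · exact (perfectClosure (Mk k x y T S₀) Ω).algebraMap_mem
          ⟨b, Lk_le_Mk S₀ (abhSet_subset_Lk S₀ hb)⟩
      · exact (perfectClosure (Mk k x y T S₀) Ω).algebraMap_mem ⟨b, subset_Mk S₀ hb⟩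
    exact hle ha

end Ambient

/-! ### Stabilization along `S ↑ P` -/

section Stabilization

variable {E F : ℕ} {x : Fin E → Ω} {y : Fin F → Ω} {T : Finset Ω}

/-- Integrality of `T` over `L_∅ = k(B)` gives it over every `L_S`. [folklore] -/
theorem isIntegral_levL_of_empty (hT : ∀ t ∈ T, IsIntegral (levL k x y (∅ : Set Ω)) t) (S : Set Ω) :
    ∀ t ∈ T, IsIntegral (levL k x y S) t := fun t ht =>
  isIntegral_levL_mono (Set.empty_subset S) (hT t ht)

/-- **The value group of `M_S` is eventually that of `M_P`** (for a valuation ring `V'` for which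
`(x, y)` is an Abhyankar system): `|M_P^×|` is finitely generated — it contains the lattice
`Λ_B = |L_P^×|` with finite index `e ≤ [M_P : L_P]` — and each generator is the value of an element
of some finite level. [folklore] -/
theorem exists_valGroup_Mk_eq {V' : ValuationSubring Ω} {hk' : ∀ c : k, algebraMap k Ω c ∈ V'}
    (hB' : IsAmbientAbhyankarSystem V' hk' x y)
    (hT : ∀ t ∈ T, IsIntegral (levL k x y (∅ : Set Ω)) t) :
    ∃ C : Finset Ω, ↑C ⊆ PSet k Ω ∧ ∀ S : Set Ω, ↑C ⊆ S → S ⊆ PSet k Ω →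
      valGroup V' (Mk k x y T S).toSubfield = valGroup V' (Mk k x y T (PSet k Ω)).toSubfield := by
  classical
  set P : Set Ω := PSet k Ω with hP
  have hPP : P ⊆ PSet k Ω := subset_rfl
  set Λ := valGroup V' (Lk k x y P).toSubfield with hΛ
  set G := valGroup V' (Mk k x y T P).toSubfield with hG
  have hΛG : Λ ≤ G := valGroup_mono V' (Lk_le_Mk (T := T) P)
  -- `[G : Λ] = e` is finite
  haveI := finiteDimensional_levM (isIntegral_levL_of_empty hT P)
  have hidx : Λ.relIndex G ≠ 0 := by
    obtain ⟨hfi, -, -⟩ := ramificationIndex_mul_inertiaDegree_le_finrank (levL k x y P)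
      (V'.comap (algebraMap (levM k x y T P) Ω))
    have h := hfi.index_ne_zero
    change ramificationIndex (levL k x y P) (V'.comap (algebraMap (levM k x y T P) Ω)) ≠ 0 at h
    rwa [ramificationIndex_level_eq_relIndex] at h
  -- `Λ` is finitely generated, hence so is `G`
  have hΛfg : Group.FG Λ := by
    rw [hΛ, hB'.valGroup_Lk_eq_closure hPP]
    refine (Group.fg_iff_subgroup_fg _).mpr ⟨(Set.finite_range fun j =>
      Units.mk0 (V'.valuation (x j)) (valuation_ne_zero_of_ne_zero V' (hB'.ne_zero j))).toFinset, ?_⟩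
    rw [Set.Finite.coe_toFinset]
  haveI : (Λ.subgroupOf G).FiniteIndex := ⟨hidx⟩
  have hHfg : (Λ.subgroupOf G).FG := by
    haveI := hΛfg
    have hsurj : Function.Surjective ((Subgroup.subgroupOfEquivOfLe hΛG).symm.toMonoidHom) :=
      (Subgroup.subgroupOfEquivOfLe hΛG).symm.surjective
    exact (Group.fg_iff_subgroup_fg _).mp (Group.fg_of_surjective hsurj)
  have hGfg : Group.FG G := group_fg_of_fg_of_finiteIndex _ hHfg
  obtain ⟨gens, hgens⟩ := (Group.fg_iff_subgroup_fg G).mp hGfg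
  -- each generator comes from a finite level
  have hdesc : ∀ γ ∈ gens, ∃ C : Finset Ω, ↑C ⊆ P ∧ γ ∈ valGroup V' (Mk k x y T (C : Set Ω)).toSubfield := by
    intro γ hγ
    have hγG : γ ∈ G := by
      rw [← hgens]
      exact Subgroup.subset_closure hγ
    obtain ⟨a, ha, hγa⟩ := hγG
    obtain ⟨C, hCP, haC⟩ := exists_finset_mem_Mk ha
    exact ⟨C, hCP, a, haC, hγa⟩
  choose Cγ hCγP hCγmem using hdesc
  refine ⟨gens.attach.biUnion fun γ => Cγ γ.1 γ.2, ?_, fun S hCS hSP => ?_⟩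
  · intro c hc
    obtain ⟨γ, -, hcγ⟩ := Finset.mem_biUnion.mp hc
    exact hCγP γ.1 γ.2 hcγ
  · have hGS : valGroup V' (Mk k x y T S).toSubfield ≤ G :=
      valGroup_mono V' (show (Mk k x y T S).toSubfield ≤ (Mk k x y T P).toSubfield from
        fun a ha => Mk_mono hSP ha)
    have hG' : G ≤ valGroup V' (Mk k x y T S).toSubfield := by
      rw [← hgens]
      refine (Subgroup.closure_le _).mpr fun γ hγ => ?_
      have hsub : (Cγ γ hγ : Set Ω) ⊆ S := fun c hc =>
        hCS (Finset.mem_biUnion.mpr ⟨⟨γ, hγ⟩, Finset.mem_attach _ _, hc⟩)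
      exact valGroup_mono V' (show (Mk k x y T (Cγ γ hγ : Set Ω)).toSubfield ≤
        (Mk k x y T S).toSubfield from fun a ha => Mk_mono hsub ha) (hCγmem γ hγ)
    exact le_antisymm hGS hG'

/-- **The ramification index of a level is eventually that of level `P`.** [folklore] -/
theorem ramificationIndex_level_eq_of_valGroup_eq {V' : ValuationSubring Ω}
    {hk' : ∀ c : k, algebraMap k Ω c ∈ V'} (hB' : IsAmbientAbhyankarSystem V' hk' x y) {S : Set Ω}
    (hS : S ⊆ PSet k Ω)
    (hval : valGroup V' (Mk k x y T S).toSubfield = valGroup V' (Mk k x y T (PSet k Ω)).toSubfield) :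
    ramificationIndex (levL k x y S) (V'.comap (algebraMap (levM k x y T S) Ω)) =
      ramificationIndex (levL k x y (PSet k Ω)) (V'.comap (algebraMap (levM k x y T (PSet k Ω)) Ω)) := by
  rw [ramificationIndex_level_eq_relIndex, ramificationIndex_level_eq_relIndex, hval,
    hB'.valGroup_Lk_eq_closure hS, hB'.valGroup_Lk_eq_closure subset_rfl]

/-- **The inertia degree of a level is eventually at least that of level `P`**: an
`L̃_P`-basis of `M̃_P` consists of residues of elements of some finite level, and an
`L̃_S`-basis of `M̃_S` then spans `M̃_P` over `L̃_P` (`relfinrank_le_relfinrank_of_span`).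
[folklore] -/
theorem exists_inertiaDegree_level_ge {V' : ValuationSubring Ω} {hk' : ∀ c : k, algebraMap k Ω c ∈ V'}
    (hB' : IsAmbientAbhyankarSystem V' hk' x y)
    (hT : ∀ t ∈ T, IsIntegral (levL k x y (∅ : Set Ω)) t) :
    ∃ C : Finset Ω, ↑C ⊆ PSet k Ω ∧ ∀ S : Set Ω, ↑C ⊆ S → S ⊆ PSet k Ω →
      inertiaDegree (levL k x y (PSet k Ω)) (V'.comap (algebraMap (levM k x y T (PSet k Ω)) Ω)) ≤
        inertiaDegree (levL k x y S) (V'.comap (algebraMap (levM k x y T S) Ω)) := by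
  classical
  have _ := hB'
  set P : Set Ω := PSet k Ω with hP
  set A' := resField V' (Lk k x y P).toSubfield with hA'
  set X' := resField V' (Mk k x y T P).toSubfield with hX'
  have hA'X' : A' ≤ X' := resField_mono V' (Lk_le_Mk (T := T) P)
  -- `[X' : A'] = f_P ≥ 1`, so `X'` is finite over `A'` with a basis
  haveI := finiteDimensional_levM (isIntegral_levL_of_empty hT P)
  have hfP : 0 < A'.relfinrank X' := by
    rw [hA', hX', ← inertiaDegree_level_eq_relfinrank]
    exact (one_le_ramificationIndex_and_inertiaDegree (levL k x y P)
      (V'.comap (algebraMap (levM k x y T P) Ω))).2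
  rw [Subfield.relfinrank_eq_finrank_of_le hA'X'] at hfP
  haveI : Module.Finite A' (Subfield.extendScalars hA'X') := Module.finite_of_finrank_pos hfP
  let b := Module.finBasis A' (Subfield.extendScalars hA'X')
  -- the basis vectors are residues of elements of finite levels
  have hdesc : ∀ i, ∃ C : Finset Ω, ↑C ⊆ P ∧
      ((b i : Subfield.extendScalars hA'X') : ResidueField V') ∈
        resField V' (Mk k x y T (C : Set Ω)).toSubfield := by
    intro i
    have hi : ((b i : Subfield.extendScalars hA'X') : ResidueField V') ∈ X' := (b i).2
    obtain ⟨a, ha, hres⟩ := (mem_resField_iff V' _ _).mp hi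
    obtain ⟨C, hCP, haC⟩ := exists_finset_mem_Mk ha
    exact ⟨C, hCP, (mem_resField_iff V' _ _).mpr ⟨a, haC, hres⟩⟩
  choose Ci hCiP hCimem using hdesc
  refine ⟨Finset.univ.biUnion Ci, ?_, fun S hCS hSP => ?_⟩
  · intro c hc
    obtain ⟨i, -, hci⟩ := Finset.mem_biUnion.mp hc
    exact hCiP i hci
  · set A := resField V' (Lk k x y S).toSubfield with hA
    set X := resField V' (Mk k x y T S).toSubfield with hX
    haveI := finiteDimensional_levM (isIntegral_levL_of_empty hT S)
    have hfin : 0 < A.relfinrank X := by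
      rw [hA, hX, ← inertiaDegree_level_eq_relfinrank]
      exact (one_le_ramificationIndex_and_inertiaDegree (levL k x y S)
        (V'.comap (algebraMap (levM k x y T S) Ω))).2
    have hGX : (Set.range fun i => ((b i : Subfield.extendScalars hA'X') : ResidueField V')) ⊆ X := by
      rintro _ ⟨i, rfl⟩
      have hsub : (Ci i : Set Ω) ⊆ S := fun c hc =>
        hCS (Finset.mem_biUnion.mpr ⟨i, Finset.mem_univ _, hc⟩)
      exact resField_mono V' (Mk_mono hsub) (hCimem i)
    have hle := relfinrank_le_relfinrank_of_span (resField_mono V' (Lk_mono hSP))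
      (resField_mono V' (Lk_le_Mk (T := T) S)) (resField_mono V' (Mk_mono hSP)) hA'X' hfin hGX
      (fun z hz => mem_span_range_of_basis hA'X' b hz)
    rw [inertiaDegree_level_eq_relfinrank, inertiaDegree_level_eq_relfinrank]
    exact hle

/-- Coordinates of an element of `M_P` in an `L_P`-basis, read in `Ω`. [folklore] -/
theorem coe_eq_sum_repr {S : Set Ω} {n : ℕ} (b : Module.Basis (Fin n) (levL k x y S) (levM k x y T S))
    (m : levM k x y T S) :
    (m : Ω) = ∑ l, ((b.repr m l : levL k x y S) : Ω) * ((b l : levM k x y T S) : Ω) := by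
  conv_lhs => rw [← b.sum_repr m]
  rw [AddSubmonoidClass.coe_finsetSum]
  refine Finset.sum_congr rfl fun l _ => ?_
  rw [IntermediateField.coe_smul, Algebra.smul_def]
  rfl

/-- **The degree `[M_S : L_S]` is eventually `[M_P : L_P]`**: an `L_P`-basis of `M_P`, its
multiplication table, and the coordinates of `1` and of the generators `T` involve finitely many
constants; at every level `S` containing them the same vectors form an `L_S`-basis of `M_S`
(they stay independent, and their `L_S`-span is a subalgebra containing `T`). [folklore] -/
theorem exists_finrank_level_eq (hT : ∀ t ∈ T, IsIntegral (levL k x y (∅ : Set Ω)) t) :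
    ∃ C : Finset Ω, ↑C ⊆ PSet k Ω ∧ ∀ S : Set Ω, ↑C ⊆ S → S ⊆ PSet k Ω →
      Module.finrank (levL k x y S) (levM k x y T S) =
        Module.finrank (levL k x y (PSet k Ω)) (levM k x y T (PSet k Ω)) := by
  classical
  set P : Set Ω := PSet k Ω with hP
  haveI := finiteDimensional_levM (isIntegral_levL_of_empty hT P)
  set n := Module.finrank (levL k x y P) (levM k x y T P) with hn
  let b := Module.finBasis (levL k x y P) (levM k x y T P)
  -- finitely many constants: basis vectors, multiplication table, `1`, and `T`
  have hdb : ∀ i, ∃ C : Finset Ω, ↑C ⊆ P ∧ ((b i : levM k x y T P) : Ω) ∈ Mk k x y T (C : Set Ω) :=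
    fun i => exists_finset_mem_Mk ((mem_levM_iff P _).mp (b i).2)
  choose Cb hCbP hCbmem using hdb
  have hdm : ∀ i j l, ∃ C : Finset Ω, ↑C ⊆ P ∧
      ((b.repr (b i * b j) l : levL k x y P) : Ω) ∈ Lk k x y (C : Set Ω) :=
    fun i j l => exists_finset_mem_Lk ((mem_levL_iff P _).mp (b.repr (b i * b j) l).2)
  choose Cm hCmP hCmmem using hdm
  have hd1 : ∀ l, ∃ C : Finset Ω, ↑C ⊆ P ∧
      ((b.repr 1 l : levL k x y P) : Ω) ∈ Lk k x y (C : Set Ω) :=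
    fun l => exists_finset_mem_Lk ((mem_levL_iff P _).mp (b.repr 1 l).2)
  choose C1 hC1P hC1mem using hd1
  let tP : T → levM k x y T P := fun t => ⟨t, (mem_levM_iff P _).mpr (subset_Mk P t.2)⟩
  have hdt : ∀ (t : T) l, ∃ C : Finset Ω, ↑C ⊆ P ∧
      ((b.repr (tP t) l : levL k x y P) : Ω) ∈ Lk k x y (C : Set Ω) :=
    fun t l => exists_finset_mem_Lk ((mem_levL_iff P _).mp (b.repr (tP t) l).2)
  choose Ct hCtP hCtmem using hdt
  refine ⟨(Finset.univ.biUnion Cb) ∪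
    (Finset.univ.biUnion fun i => Finset.univ.biUnion fun j => Finset.univ.biUnion fun l => Cm i j l) ∪
    (Finset.univ.biUnion C1) ∪ (T.attach.biUnion fun t => Finset.univ.biUnion fun l => Ct t l),
    ?_, fun S hCS hSP => ?_⟩
  · intro c hc
    rcases Finset.mem_union.mp hc with hc | hc
    · rcases Finset.mem_union.mp hc with hc | hc
      · rcases Finset.mem_union.mp hc with hc | hc
        · obtain ⟨i, -, hc⟩ := Finset.mem_biUnion.mp hc
          exact hCbP i hc
        · obtain ⟨i, -, hc⟩ := Finset.mem_biUnion.mp hc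
          obtain ⟨j, -, hc⟩ := Finset.mem_biUnion.mp hc
          obtain ⟨l, -, hc⟩ := Finset.mem_biUnion.mp hc
          exact hCmP i j l hc
      · obtain ⟨l, -, hc⟩ := Finset.mem_biUnion.mp hc
        exact hC1P l hc
    · obtain ⟨t, -, hc⟩ := Finset.mem_biUnion.mp hc
      obtain ⟨l, -, hc⟩ := Finset.mem_biUnion.mp hc
      exact hCtP t l hc
  · -- everything descended lies in the level `S`
    have hCbS : ∀ i, ((b i : levM k x y T P) : Ω) ∈ Mk k x y T S := fun i =>
      Mk_mono (fun c hc => hCS (Finset.mem_union_left _ (Finset.mem_union_left _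
        (Finset.mem_union_left _ (Finset.mem_biUnion.mpr ⟨i, Finset.mem_univ _, hc⟩))))) (hCbmem i)
    have hCmS : ∀ i j l, ((b.repr (b i * b j) l : levL k x y P) : Ω) ∈ Lk k x y S := fun i j l =>
      Lk_mono (fun c hc => hCS (Finset.mem_union_left _ (Finset.mem_union_left _
        (Finset.mem_union_right _ (Finset.mem_biUnion.mpr ⟨i, Finset.mem_univ _,
          Finset.mem_biUnion.mpr ⟨j, Finset.mem_univ _, Finset.mem_biUnion.mpr
            ⟨l, Finset.mem_univ _, hc⟩⟩⟩))))) (hCmmem i j l)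
    have hC1S : ∀ l, ((b.repr 1 l : levL k x y P) : Ω) ∈ Lk k x y S := fun l =>
      Lk_mono (fun c hc => hCS (Finset.mem_union_left _ (Finset.mem_union_right _
        (Finset.mem_biUnion.mpr ⟨l, Finset.mem_univ _, hc⟩)))) (hC1mem l)
    have hCtS : ∀ (t : T) l, ((b.repr (tP t) l : levL k x y P) : Ω) ∈ Lk k x y S := fun t l =>
      Lk_mono (fun c hc => hCS (Finset.mem_union_right _ (Finset.mem_biUnion.mpr
        ⟨t, Finset.mem_attach _ _, Finset.mem_biUnion.mpr ⟨l, Finset.mem_univ _, hc⟩⟩))) (hCtmem t l)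
    haveI := finiteDimensional_levM (isIntegral_levL_of_empty hT S)
    -- the span of the basis vectors over `L_S`
    let v : Fin n → Ω := fun i => ((b i : levM k x y T P) : Ω)
    set N : Submodule (levL k x y S) Ω := Submodule.span (levL k x y S) (Set.range v) with hN
    -- a sum `∑ c_l b_l` with coefficients in `L_S` lies in `N`
    have hsumN : ∀ (c : Fin n → Ω), (∀ l, c l ∈ Lk k x y S) → ∑ l, c l * v l ∈ N := by
      intro c hc
      refine Submodule.sum_mem _ fun l _ => ?_
      have h1 : c l * v l = (⟨c l, (mem_levL_iff S _).mpr (hc l)⟩ : levL k x y S) • v l := by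
        rw [Algebra.smul_def]; rfl
      rw [h1]
      exact Submodule.smul_mem _ _ (Submodule.subset_span ⟨l, rfl⟩)
    have hmulN : ∀ i j, v i * v j ∈ N := by
      intro i j
      have h := coe_eq_sum_repr b (b i * b j)
      rw [MulMemClass.coe_mul] at h
      change v i * v j = _ at h
      rw [h]
      exact hsumN _ (hCmS i j)
    have h1N : (1 : Ω) ∈ N := by
      have h := coe_eq_sum_repr b 1
      rw [OneMemClass.coe_one] at h
      rw [h]
      exact hsumN _ hC1S
    have hTN : ∀ t ∈ T, t ∈ N := by
      intro t ht
      have h := coe_eq_sum_repr b (tP ⟨t, ht⟩)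
      change t = _ at h
      rw [h]
      exact hsumN _ (hCtS ⟨t, ht⟩)
    have hNN : N * N ≤ N := by
      rw [hN, Submodule.span_mul_span]
      refine Submodule.span_le.mpr ?_
      rintro _ ⟨_, ⟨i, rfl⟩, _, ⟨j, rfl⟩, rfl⟩
      exact hmulN i j
    let NA : Subalgebra (levL k x y S) Ω := N.toSubalgebra h1N fun z w hz hw =>
      hNN (Submodule.mul_mem_mul hz hw)
    -- `M_S ⊆ N`
    have hMkN : ∀ a ∈ Mk k x y T S, a ∈ N := by
      intro a ha
      have ha' : a ∈ ((adjoin (levL k x y S) (T : Set Ω)) : Set Ω) := by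
        rw [adjoin_levL_eq_levM, coe_levM]; exact ha
      have halg : ∀ t ∈ (T : Set Ω), IsAlgebraic (levL k x y S) t := fun t ht =>
        (isIntegral_levL_of_empty hT S t ht).isAlgebraic
      have ha'' : a ∈ (adjoin (levL k x y S) (T : Set Ω)).toSubalgebra := ha'
      rw [adjoin_toSubalgebra_of_isAlgebraic halg] at ha''
      have hle : Algebra.adjoin (levL k x y S) (T : Set Ω) ≤ NA := Algebra.adjoin_le hTN
      exact hle ha''
    -- the basis at level `S`
    let w : Fin n → levM k x y T S := fun i => ⟨v i, (mem_levM_iff S _).mpr (hCbS i)⟩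
    have hli : LinearIndependent (levL k x y S) w := by
      rw [Fintype.linearIndependent_iff]
      intro g hg i
      -- push the relation to `M_P`
      have hgΩ : ∑ l, ((g l : levL k x y S) : Ω) * v l = 0 := by
        have h := congrArg (fun m : levM k x y T S => (m : Ω)) hg
        simp only [AddSubmonoidClass.coe_finsetSum, ZeroMemClass.coe_zero] at h
        rw [← h]
        refine Finset.sum_congr rfl fun l _ => ?_
        rw [IntermediateField.coe_smul, Algebra.smul_def]
        rfl
      let g' : Fin n → levL k x y P := fun l => inclL k x y hSP (g l)
      have hg' : ∑ l, g' l • (b l : levM k x y T P) = 0 := by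
        apply Subtype.val_injective
        simp only [AddSubmonoidClass.coe_finsetSum, ZeroMemClass.coe_zero]
        rw [← hgΩ]
        refine Finset.sum_congr rfl fun l _ => ?_
        rw [IntermediateField.coe_smul, Algebra.smul_def]
        change ((inclL k x y hSP (g l) : levL k x y P) : Ω) * v l = _
        rw [coe_inclL]
      have h0 := (Fintype.linearIndependent_iff.mp b.linearIndependent) g' hg' i
      apply Subtype.val_injective
      have h1 : ((g' i : levL k x y P) : Ω) = 0 := by rw [h0]; rfl
      rwa [show ((g' i : levL k x y P) : Ω) = g i from coe_inclL hSP (g i)] at h1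
    have hsp : ⊤ ≤ Submodule.span (levL k x y S) (Set.range w) := by
      rintro z -
      have hinj : Function.Injective ((levM k x y T S).val.toLinearMap) :=
        (levM k x y T S).val.toRingHom.injective
      rw [← Submodule.apply_mem_span_image_iff_mem_span hinj, ← Set.range_comp]
      exact hMkN z ((mem_levM_iff S _).mp z.2)
    rw [Module.finrank_eq_card_basis (Module.Basis.mk hli hsp), Fintype.card_fin]

/-- **Restriction of valuation rings from `M_P` to `M_S` is eventually injective on any finite
set**: two distinct valuation rings of `M_P` differ at an element of some finite level.
[folklore] -/
theorem exists_injOn_comap_inclM (𝒯 : Finset (ValuationSubring (levM k x y T (PSet k Ω)))) :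
    ∃ C : Finset Ω, ↑C ⊆ PSet k Ω ∧ ∀ (S : Set Ω), ↑C ⊆ S → ∀ hSP : S ⊆ PSet k Ω,
      Set.InjOn (fun W : ValuationSubring (levM k x y T (PSet k Ω)) => W.comap (inclM k x y T hSP))
        ↑𝒯 := by
  classical
  -- a separating element for each pair of distinct members
  have hsep : ∀ p : ValuationSubring (levM k x y T (PSet k Ω)) × ValuationSubring (levM k x y T (PSet k Ω)),
      p.1 ≠ p.2 → ∃ z : levM k x y T (PSet k Ω), ¬ (z ∈ p.1 ↔ z ∈ p.2) := by
    intro p hp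
    by_contra hall
    push Not at hall
    exact hp (SetLike.ext hall)
  have hdesc : ∀ p : ValuationSubring (levM k x y T (PSet k Ω)) × ValuationSubring (levM k x y T (PSet k Ω)),
      ∃ C : Finset Ω, ↑C ⊆ PSet k Ω ∧ (p.1 ≠ p.2 → ∃ z : levM k x y T (PSet k Ω),
        ¬ (z ∈ p.1 ↔ z ∈ p.2) ∧ (z : Ω) ∈ Mk k x y T (C : Set Ω)) := by
    intro p
    by_cases hp : p.1 = p.2
    · exact ⟨∅, by simp, fun h => (h hp).elim⟩
    · obtain ⟨z, hz⟩ := hsep p hp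
      obtain ⟨C, hCP, hzC⟩ := exists_finset_mem_Mk ((mem_levM_iff (PSet k Ω) _).mp z.2)
      exact ⟨C, hCP, fun _ => ⟨z, hz, hzC⟩⟩
  choose Cp hCpP hCpsep using hdesc
  refine ⟨(𝒯 ×ˢ 𝒯).biUnion Cp, ?_, fun S hCS hSP => ?_⟩
  · intro c hc
    obtain ⟨p, -, hcp⟩ := Finset.mem_biUnion.mp hc
    exact hCpP p hcp
  · intro W₁ hW₁ W₂ hW₂ heq
    by_contra hne
    obtain ⟨z, hz, hzC⟩ := hCpsep (W₁, W₂) hne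
    have hzS : (z : Ω) ∈ Mk k x y T S :=
      Mk_mono (fun c hc => hCS (Finset.mem_biUnion.mpr ⟨(W₁, W₂), Finset.mem_product.mpr ⟨hW₁, hW₂⟩, hc⟩)) hzC
    let z' : levM k x y T S := ⟨z, (mem_levM_iff S _).mpr hzS⟩
    have hz' : inclM k x y T hSP z' = z := Subtype.ext (coe_inclM hSP z')
    have h1 : z' ∈ W₁.comap (inclM k x y T hSP) ↔ z' ∈ W₂.comap (inclM k x y T hSP) := by
      rw [show W₁.comap (inclM k x y T hSP) = W₂.comap (inclM k x y T hSP) from heq]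
    rw [ValuationSubring.mem_comap, ValuationSubring.mem_comap, hz'] at h1
    exact hz h1

end Stabilization

/-! ### The counting theorem: the inertia degree stabilizes -/

section Counting

variable {V : ValuationSubring Ω} {hk : ∀ c : k, algebraMap k Ω c ∈ V} {E F : ℕ} {x : Fin E → Ω}
  {y : Fin F → Ω} {T : Finset Ω}

/-- Termwise equality from two defect formulas: if `∑ eᵢ fᵢ = ∑ eᵢ f'ᵢ` with `eᵢ > 0` and
`f'ᵢ ≤ fᵢ`, then `fᵢ = f'ᵢ`. [folklore] -/
theorem eq_of_sum_mul_eq_sum_mul {ι : Type*} (s : Finset ι) (e f f' : ι → ℕ) (he : ∀ i ∈ s, 0 < e i)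
    (hle : ∀ i ∈ s, f' i ≤ f i) (hsum : ∑ i ∈ s, e i * f i = ∑ i ∈ s, e i * f' i) :
    ∀ i ∈ s, f i = f' i := by
  have hle' : ∀ i ∈ s, e i * f' i ≤ e i * f i := fun i hi => Nat.mul_le_mul_left _ (hle i hi)
  have h := (Finset.sum_eq_sum_iff_of_le hle').mp hsum.symm
  intro i hi
  exact (Nat.eq_of_mul_eq_mul_left (he i hi) (h i hi)).symm

/-- Membership in the set of extensions, ambient form: `V' ∩ M_S` lies over `V ∩ L_S` iff `V'` and
`V` have the same trace on `L_S`. [folklore] -/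
theorem comap_levM_comap_eq_iff (S : Set Ω) (V' : ValuationSubring Ω) :
    (V'.comap (algebraMap (levM k x y T S) Ω)).comap (algebraMap (levL k x y S) (levM k x y T S)) =
        V.comap (algebraMap (levL k x y S) Ω) ↔
      ∀ a ∈ Lk k x y S, a ∈ V' ↔ a ∈ V := by
  rw [comap_levM_comap_levL, comap_levL_eq_iff]

/-- **The counting theorem** (Temkin 2013, Thm. 5.5.3, core of the proof from the generalized
stability theorem): if `Kuhlmann2010Stability` holds, `(x, y)` is an Abhyankar system of `(Ω, V)`
over the trivially valued `k`, and `T` is integral over `k(B)`, then for every set of constants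
`S ⊆ P = k^{1/p^∞} ∩ Ω` containing a certain finite set, the inertia degree of `V ∩ M_S` over
`L_S = k(S, B)` equals that of `V ∩ M_P` over `L_P` (`M = L(T)`). Proof: by stability at the levels
`S` and `P`, `∑ e f = [M : L]` over all extensions of `V ∩ L` to `M` at both levels; for `S` large
the extensions correspond bijectively under restriction, `[M_S : L_S] = [M_P : L_P]`, the
ramification indices agree and the inertia degrees at level `S` are at least those at level `P`,
so they are equal term by term. [cite: Temkin2013, Thm. 5.5.3 (p. 61 of arXiv:0804.1554v3)] -/
theorem exists_inertiaDegree_level_eq (hKS : Kuhlmann2010Stability.{u})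
    (hB : IsAmbientAbhyankarSystem V hk x y) (hT : ∀ t ∈ T, IsIntegral (levL k x y (∅ : Set Ω)) t) :
    ∃ C : Finset Ω, ↑C ⊆ PSet k Ω ∧ ∀ S : Set Ω, ↑C ⊆ S → S ⊆ PSet k Ω →
      inertiaDegree (levL k x y S) (V.comap (algebraMap (levM k x y T S) Ω)) =
        inertiaDegree (levL k x y (PSet k Ω)) (V.comap (algebraMap (levM k x y T (PSet k Ω)) Ω)) := by
  classical
  have hPP : PSet k Ω ⊆ PSet k Ω := subset_rfl
  -- the extensions at level `P` and ambient representatives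
  obtain ⟨𝒯P, hmemP, hsumP⟩ := isDefectlessIn_level hKS hB (isIntegral_levL_of_empty hT _) hPP
  choose VW hVW using fun W : ValuationSubring (levM k x y T (PSet k Ω)) =>
    exists_valuationSubring_comap_eq (Ω := Ω) W
  have hagreeP : ∀ W ∈ 𝒯P, ∀ a ∈ Lk k x y (PSet k Ω), a ∈ VW W ↔ a ∈ V := by
    intro W hW
    have h := (hmemP W).mp hW
    rw [← hVW W] at h
    exact (comap_levM_comap_eq_iff _ _).mp h
  have hagree : ∀ W ∈ 𝒯P, ∀ S : Set Ω, S ⊆ PSet k Ω → ∀ a ∈ Lk k x y S, a ∈ VW W ↔ a ∈ V :=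
    fun W hW S hS => forall_mem_Lk_iff_of_forall_mem_Lk_iff hS (hagreeP W hW)
  have hkW : ∀ W ∈ 𝒯P, ∀ c : k, algebraMap k Ω c ∈ VW W := fun W hW c =>
    (hagreeP W hW _ ((Lk k x y (PSet k Ω)).algebraMap_mem c)).mpr (hk c)
  have hBW : ∀ W (hW : W ∈ 𝒯P), IsAmbientAbhyankarSystem (VW W) (hkW W hW) x y := fun W hW =>
    hB.of_forall_mem_iff (hkW W hW) fun a ha =>
      ((hagree W hW ∅ (Set.empty_subset _)) a ha).symm
  -- thresholds
  choose Cb hCbP hCb using fun W (hW : W ∈ 𝒯P) => exists_valGroup_Mk_eq (T := T) (hBW W hW) hT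
  choose Cc hCcP hCc using fun W (hW : W ∈ 𝒯P) => exists_inertiaDegree_level_ge (T := T) (hBW W hW) hT
  obtain ⟨Ca, hCaP, hCa⟩ := exists_finrank_level_eq (k := k) (x := x) (y := y) (T := T) hT
  obtain ⟨Cr, hCrP, hCr⟩ := exists_injOn_comap_inclM (k := k) (x := x) (y := y) (T := T) 𝒯P
  refine ⟨Ca ∪ Cr ∪ 𝒯P.attach.biUnion (fun W => Cb W.1 W.2 ∪ Cc W.1 W.2), ?_, fun S hCS hSP => ?_⟩
  · intro c hc
    rcases Finset.mem_union.mp hc with hc | hc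
    · rcases Finset.mem_union.mp hc with hc | hc
      · exact hCaP hc
      · exact hCrP hc
    · obtain ⟨W, -, hc⟩ := Finset.mem_biUnion.mp hc
      rcases Finset.mem_union.mp hc with hc | hc
      · exact hCbP W.1 W.2 hc
      · exact hCcP W.1 W.2 hc
  · have hCaS : ↑Ca ⊆ S := fun c hc => hCS (Finset.mem_union_left _ (Finset.mem_union_left _ hc))
    have hCrS : ↑Cr ⊆ S := fun c hc => hCS (Finset.mem_union_left _ (Finset.mem_union_right _ hc))
    have hCbS : ∀ W (hW : W ∈ 𝒯P), ↑(Cb W hW) ⊆ S := fun W hW c hc =>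
      hCS (Finset.mem_union_right _ (Finset.mem_biUnion.mpr
        ⟨⟨W, hW⟩, Finset.mem_attach _ _, Finset.mem_union_left _ hc⟩))
    have hCcS : ∀ W (hW : W ∈ 𝒯P), ↑(Cc W hW) ⊆ S := fun W hW c hc =>
      hCS (Finset.mem_union_right _ (Finset.mem_biUnion.mpr
        ⟨⟨W, hW⟩, Finset.mem_attach _ _, Finset.mem_union_right _ hc⟩))
    -- the extensions at level `S`
    obtain ⟨𝒯S, hmemS, hsumS⟩ := isDefectlessIn_level hKS hB (isIntegral_levL_of_empty hT _) hSP
    let ρ : ValuationSubring (levM k x y T (PSet k Ω)) → ValuationSubring (levM k x y T S) :=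
      fun W => W.comap (inclM k x y T hSP)
    have hρ : ∀ W, ρ W = (VW W).comap (algebraMap (levM k x y T S) Ω) := fun W => by
      change W.comap (inclM k x y T hSP) = _
      rw [← hVW W, comap_inclM_comap, hVW W]
    -- `ρ` maps `𝒯P` onto `𝒯S`
    have himage : 𝒯S = 𝒯P.image ρ := by
      ext WS
      rw [Finset.mem_image]
      constructor
      · intro hWS
        obtain ⟨V'', hV''⟩ := exists_valuationSubring_comap_eq (Ω := Ω) WS
        have hagS : ∀ a ∈ Lk k x y S, a ∈ V'' ↔ a ∈ V := by
          have h := (hmemS WS).mp hWS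
          rw [← hV''] at h
          exact (comap_levM_comap_eq_iff _ _).mp h
        have hagP : ∀ a ∈ Lk k x y (PSet k Ω), a ∈ V'' ↔ a ∈ V :=
          forall_mem_Lk_iff_of_forall_mem_Lk_iff hPP hagS
        refine ⟨V''.comap (algebraMap (levM k x y T (PSet k Ω)) Ω), ?_, ?_⟩
        · exact (hmemP _).mpr ((comap_levM_comap_eq_iff _ _).mpr hagP)
        · change (V''.comap _).comap (inclM k x y T hSP) = WS
          rw [comap_inclM_comap, hV'']
      · rintro ⟨W, hW, rfl⟩
        refine (hmemS _).mpr ?_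
        rw [hρ W]
        exact (comap_levM_comap_eq_iff _ _).mpr (hagree W hW S hSP)
    -- compare the two defect formulas
    have hinj : Set.InjOn ρ ↑𝒯P := hCr S hCrS hSP
    rw [himage, Finset.sum_image hinj, hCa S hCaS hSP, ← hsumP] at hsumS
    -- rewrite the level-`S` invariants through the ambient representatives
    have heq : ∀ W ∈ 𝒯P, ramificationIndex (levL k x y S) (ρ W) =
        ramificationIndex (levL k x y (PSet k Ω)) W := by
      intro W hW
      rw [hρ W, ramificationIndex_level_eq_of_valGroup_eq (hBW W hW) hSP (hCb W hW S (hCbS W hW) hSP),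
        hVW W]
    have hge : ∀ W ∈ 𝒯P, inertiaDegree (levL k x y (PSet k Ω)) W ≤
        inertiaDegree (levL k x y S) (ρ W) := by
      intro W hW
      have h := hCc W hW S (hCcS W hW) hSP
      rw [hVW W] at h
      rw [hρ W]
      exact h
    have hsum' : ∑ W ∈ 𝒯P, ramificationIndex (levL k x y (PSet k Ω)) W *
        inertiaDegree (levL k x y S) (ρ W) =
        ∑ W ∈ 𝒯P, ramificationIndex (levL k x y (PSet k Ω)) W *
          inertiaDegree (levL k x y (PSet k Ω)) W := by
      rw [← hsumS]
      exact Finset.sum_congr rfl fun W hW => by rw [heq W hW]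
    haveI := finiteDimensional_levM (isIntegral_levL_of_empty hT (PSet k Ω))
    have hpos : ∀ W ∈ 𝒯P, 0 < ramificationIndex (levL k x y (PSet k Ω)) W := fun W _ =>
      (one_le_ramificationIndex_and_inertiaDegree (levL k x y (PSet k Ω)) W).1
    have hall := eq_of_sum_mul_eq_sum_mul 𝒯P _ _ _ hpos hge hsum'
    -- apply to `W₀ = V ∩ M_P`
    set W₀ := V.comap (algebraMap (levM k x y T (PSet k Ω)) Ω) with hW₀
    have hW₀ : W₀ ∈ 𝒯P := (hmemP W₀).mpr (comap_levM_comap_levL _ _)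
    have h := hall W₀ hW₀
    rw [hρ W₀] at h
    -- `VW W₀` and `V` agree on `M_P ⊇ M_S`
    have hagM : ∀ a ∈ Mk k x y T S, a ∈ VW W₀ ↔ a ∈ V := fun a ha =>
      (comap_levM_eq_iff (PSet k Ω) (VW W₀) V).mp (hVW W₀) a (Mk_mono hSP ha)
    rw [(comap_levM_eq_iff S (VW W₀) V).mpr hagM] at h
    exact h

end Counting

end Literature.AlgebraicGeometry.Resolution

end
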